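import Summits.HodgeConjecture.HodgeConjecture.Theorems.F0P3bArchDegOneClass
import Summits.HodgeConjecture.HodgeConjecture.Theorems.F0P3bKTypeIntegrationGK
import Literature.RepresentationTheory.GKModuleIrrClass
import Literature.RepresentationTheory.BorelWallach2000.UpqTypeFunctoriality
import Literature.RepresentationTheory.BorelWallach2000.GKCohomologyCentralCharacter
import Summits.HodgeConjecture.HodgeConjecture.Theorems.K2E1bTypeClassesBotTransport   -- ★ PAID socket #15 (p854766, K2E1b-p13) — re-tie by import (ED. 2)
import Summits.HodgeConjecture.HodgeConjecture.Theorems.K2E1bArchDegOneClassChi   -- ★ PAID socket #16 (p854780, K2E1b-p14) — re-tie by import (ED. 2)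
import Summits.HodgeConjecture.HodgeConjecture.Theorems.K2E1bDegOneFinrankEqTwo   -- ★ PAID socket #17 (p854769, K2E1b-p15) — re-tie by import (ED. 2)
import Summits.HodgeConjecture.HodgeConjecture.Theorems.K2E1bClassEqArchDegOneOfPType   -- ★ PAID socket #18 (p854903, K2E1b-p16) — re-tie by import (ED. 3)

/-!
# K2 ∕ E1b tier 1 · units U4 «CLASS TRANSPORT», U5 «PINS + ROW 10», U6 «LEVEL-B PIN» — cohomology-side sockets `sig_K2E1b*`

Tier-1 socket module `Cruxes/H413/Lines/K2_E1b_GKCohomologyU21_U456_Cohomology.lean` (flat name, see U0) of the tier-0 line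
`Cruxes/H413/Lines/K2_E1b_GKCohomologyU21.lean`; item h413 = stmt-HodgeConjecture-24833; author K2E1b-plan (g0); CHAIR ORDERS #1–#2, RULING R3 (K2-lead g0).
Imports ★ only; every `def` named below is ★ (`upqTypeClasses`, `GKIrrep`, `GKIrrClass.mk`, `archDegOneClass`, `IsCohUnitaryIrrep`, `upqCasimirOp`,
`ActsOnKTypes`, `kvec`) — R3 (d)-clean.  The tier-0 predicates appear UNFOLDED (`NoDegOneClass x` = «every irreducible `(𝔤,K)`-module in the class
`x` has `upqTypeClasses … 1 (±1) = ⊥`»; `IsChiPinnedCohUnitary x κ e` = «∃ representative, `IsCohUnitaryIrrep` + χ-scalars `(κ, e)`»).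
HONEST LABEL: HC_CM is proved only modulo the 7 printed citations (2 remaining named inputs: hLiu418 = stmt-HodgeConjecture-24832,
h413 = stmt-HodgeConjecture-24833) until rung 0 closes; this module proves nothing (every `sig_` is a `sorry`d socket).

WHAT THESE PAY.  U4 + ★ W1∕W2 (`upqTypeClasses_eq_bot_of_upqCasimirOp_eq_smul` ∕ `…_of_I_smul_one_eq_smul`, `GKCohomologyCentralCharacter`) give the
tier-0 stub «WIGNER» (`K2E1bGKCohomologyU21.stub_wigner`, FILE `Theorems/K2E1bWignerAssembly.lean`, size S–M, FIRST RUNG of the line): a χ-pinned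
class with `(κ, e) ≠ (0, 0)` has a representative killed by W1∕W2, and U4 transports `= ⊥` to every irreducible module in the class.  U5 is the
identity-level service for E1's junction J1 and for row 10 (`stub_multiplicity_le_one_printed`, a3_liu413.lean:302, dim-1 half): the ★ class of record
`archDegOneClass δ` [X1′] is χ-pinned at `(0, 0)` and its `H¹_δ` is EXACTLY a complex line.  U6 is the LEVEL-B pin in `K`-type coordinates: a
coh-unitary module with Kovačević `K`-types, Casimir `0`, containing a `𝔭`-type `V_{2,±3}` IS `archDegOneClass (±1)` [BW VI 4.11 (1)–(3) rigidity, ★ T6c∕T6r].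
[cite: BorelWallach2000, VI Thm. 4.11 (1)–(3); I Thm. 5.3; II Prop. 3.1] [cite: Rogawski1990, Prop. 15.2.1 (a)(b) p. 249; §12.3 p. 178] [cite: VoganZuckerman1984, Thm. 5.6]
-/

set_option autoImplicit false
set_option linter.dupNamespace false

noncomputable section

/-! ED. 3 — ALL FOUR U456 SOCKETS ★ PAID (re-tied by import, statement bytes frozen): #15 `sig_K2E1bTypeClassesBotTransport` (p854766, K2E1b-p13),
#16 `sig_K2E1bArchDegOneClassChi` (p854780, K2E1b-p14), #17 `sig_K2E1bDegOneFinrankEqTwo` (p854769, K2E1b-p15), #18 `sig_K2E1bClassEqArchDegOneOfPType`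
(p854903, K2E1b-p16; satellite p854877); 0 sorries. -/

namespace Summit.HodgeConjecture.HodgeConjecture.Cruxes.H413.K2E1bGKCohomologyU21.U456

open Literature.NumberTheory.Automorphic
open Literature.RepresentationTheory
open Literature.RepresentationTheory.BorelWallach2000
open Literature.RepresentationTheory.KonnoKonno2007 Literature.RepresentationTheory.KonnoKonno2007.RealDualPair
open Literature.RepresentationTheory.KonnoKonno2007.RealDualPair.UForm
open Summit.HodgeConjecture.HodgeConjecture.Cruxes.H413.F0P3bLocalAPacketsDefs
open Summit.HodgeConjecture.HodgeConjecture.Cruxes.H413.F0P3bArchDegOnePackage (IsCohUnitaryIrrep)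
open Summit.HodgeConjecture.HodgeConjecture.Cruxes.H413.F0P3bArchDegOneClass (archDegOneClass)
open Summit.HodgeConjecture.HodgeConjecture.Cruxes.H413.F0P3bKTypeIntegration (KIdx kvec kTypeRep ActsOnKTypes)

-- Mathlib idiom (as in `GKModules`, `GKCohomology`, the `Upq*` files): commutator bracket on `Module.End`
attribute [local instance 100] LieRing.ofAssociativeRing

/-! ## U4 — transport of «`H^n_δ = 0`» along `(𝔤, K)`-equivalence, in class currency -/

/-- **FILE `Theorems/K2E1bTypeClassesBotTransport.lean` (size M; FIRST RUNG together with `K2E1bWignerAssembly`).**  Vanishing of a Hodge piece of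
classes is a CLASS INVARIANT: two bundled irreducible `(𝔲(2,1), K)`-modules with the same class in ★ `GKIrrClass` are `(𝔤, K)`-equivalent
(★ `GKIrrClass.mk_eq_mk_iff`), and ★ `GKEquiv.upqTypeClassesEquiv` (`UpqTypeFunctoriality`) is a linear equivalence of the type-`(n, δ)` pieces, so
`= ⊥` transports.  With this, tier 0's `NoDegOneClass x` follows from `= ⊥` for ONE representative (every `GKIrrClass.ofModule M … = x` is `mk` of a bundle).
WHY IT MIGHT FAIL: not expected — pure functoriality; listed as a socket because three files consume it BY NAME.
[BorelWallach2000 I §4.3, I Thm. 5.3] [KnappVogan1995 §II.4]  audit: BW p0038.txt:L31–35 (I 5.3 frame); functoriality is ★ p848917.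
deps: ★ GKModuleIrrClass (`mk_eq_mk_iff`, `ofModule_eq_mk`), ★ UpqTypeFunctoriality (`GKEquiv.upqTypeClassesEquiv`), Mathlib `Submodule.eq_bot_iff` ∕ `LinearEquiv.map_eq_zero_iff`.
[cite: BorelWallach2000, I §4.3; I Thm. 5.3] [cite: KnappVogan1995, §II.4] -/
theorem sig_K2E1bTypeClassesBotTransport :
    ∀ (r₁ r₂ : GKIrrep G21), GKIrrClass.mk r₁ = GKIrrClass.mk r₂ →
      ∀ (n : ℕ) (δ : ℤ), upqTypeClasses r₁.ρK r₁.ρ𝔤 r₁.isGKModule.ad_compat n δ = ⊥ →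
        upqTypeClasses r₂.ρK r₂.ρ𝔤 r₂.isGKModule.ad_compat n δ = ⊥ :=
  Summit.HodgeConjecture.HodgeConjecture.Cruxes.H413.K2E1bTypeClassesBotTransport.typeClassesBotTransport  -- ★ PAID (p854766, K2E1b-p13): re-tied by import (ED. 2)

/-! ## U5 — the pins of the class of record and the row-10 dimension -/

/-- **FILE `Theorems/K2E1bArchDegOneClassChi.lean` (size S–M; JUNCTION J1 service, OWNER K2E1b).**  The ★ class of record `archDegOneClass δ`
(X1′: the class of the irreducible unitary cohomological module with `H¹_δ ≠ 0`, i.e. `[J^δ_{φ₀}]` [R90 Prop. 15.2.1 (b)]) is χ-PINNED AT `(κ, e) = (0, 0)`: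
its representative of record (★ `archDegOneClass_spec`) has `H¹ ≠ 0`, so by ★ Wigner in contrapositive form (★ `upqCasimirOp` acts by a scalar on an
irreducible admissible module, ★ `F0P3cWignerCasimirCentral` ∕ `GKModulesDixmierSchur`; a non-zero scalar kills all cohomology, ★ W1; likewise the
centre `i·1` acts by a scalar `e·i` which must be `0`, ★ W2).  This is the `(0,0)`-row of tier 0's `IsChiPinnedCohUnitary (archDegOneClass δ) 0 0`, UNFOLDED.
WHY IT MIGHT FAIL: the Dixmier–Schur step needs admissibility + irreducibility over `ℂ` of the representative (both in ★ `IsCohUnitaryIrrep`); the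
integrality `e ∈ ℤ` of the central scalar comes from the `K`-action on the centre `U(1) ⊂ K`.
[BorelWallach2000 I Thm. 5.3; II Cor. 3.2] [Rogawski1990 Prop. 15.2.1 (b)]  audit: BW p0038.txt:L31–35 «5.3 Theorem … if the infinitesimal character of V
differs from that of F then H*(𝔤,K; V ⊗ F) = 0» (chunk p0038 ≈ printed p. 31); R90 p0244.txt:L10–13 (15.2.1 (b)).
deps: ★ F0P3bArchDegOneClass (`archDegOneClass_spec`), ★ GKCohomologyCentralCharacter (W1∕W2), ★ F0P3cWignerCasimirCentral, ★ GKModulesDixmierSchur.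
[cite: BorelWallach2000, I Thm. 5.3; II Cor. 3.2] [cite: Rogawski1990, Prop. 15.2.1 (b)] -/
theorem sig_K2E1bArchDegOneClassChi :
    ∀ (δ : ℤ) (hδ : δ = 1 ∨ δ = -1), ∃ r : GKIrrep G21, GKIrrClass.mk r = archDegOneClass δ hδ ∧ IsCohUnitaryIrrep r.ρK r.ρ𝔤 ∧
      (∀ v : r.V, upqCasimirOp r.ρ𝔤 v = (((0 : ℤ) : ℂ)) • v) ∧
        ∀ Z : G21.lie, (Z : Matrix (Fin 2 ⊕ Fin 1) (Fin 2 ⊕ Fin 1) ℂ) = Complex.I • (1 : Matrix (Fin 2 ⊕ Fin 1) (Fin 2 ⊕ Fin 1) ℂ) →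
          ∀ v : r.V, r.ρ𝔤 Z v = (((0 : ℤ) : ℂ) * Complex.I) • v :=
  Summit.HodgeConjecture.HodgeConjecture.Cruxes.H413.K2E1bArchDegOneClassChi.archDegOneClassChi  -- ★ PAID (p854780, K2E1b-p14): re-tied by import (ED. 2)

/-- **FILE `Theorems/K2E1bDegOneFinrankEqTwo.lean` (size M; ROW-10 service for `stub_multiplicity_le_one_printed` (a3_liu413.lean:302), dim-1 half;
OWNER K2E1b).**  `dim_ℂ H¹_δ(J^δ) = 1` EXACTLY: for an irreducible unitary cohomological `(𝔲(2,1), K)`-module, a NON-ZERO degree-one Hodge piece of type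
`δ = ±1` has real dimension `2` — ★ T6b (`stubT6bDegOneTypeFinrank_holds`: finite, `finrank_ℝ ≤ 2`) gives the upper bound; the piece is a COMPLEX
subspace (stable under the complex structure induced by `z₀`, ★ `UpqHodgeBigrading`), so its real dimension is even, hence `2`.
WHY IT MIGHT FAIL: only if ★ `upqTypeClasses … 1 δ` is not literally `I`-stable as a real submodule of `H¹` (then restate over ★ `upqTypeComplexClasses` if present).
[BorelWallach2000 VI Thm. 4.11 (3)] [Rogawski1990 Prop. 15.2.1 (b): «H¹(π ⊗ F) = ℂ»]  audit: BW p0168.txt:L6–9 (4.11 (3) «… and these spaces are one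
dimensional»); R90 p0244.txt:L10–13.
deps: ★ F0P3bArchDegOnePackage (`stubT6bDegOneTypeFinrank_holds`), ★ UpqHodgeBigrading (`upqTypeClasses`, `I`-stability), Mathlib `Module.finrank` parity via a complex structure.
[cite: BorelWallach2000, VI Thm. 4.11 (3)] [cite: Rogawski1990, Prop. 15.2.1 (b)] -/
theorem sig_K2E1bDegOneFinrankEqTwo :
    ∀ (V : Type) [AddCommGroup V] [Module ℂ V]
      (ρK : Representation ℂ (uFormGroup (Fin 2) (Fin 1)).maximalCompact V)
      (ρ𝔤 : (uFormGroup (Fin 2) (Fin 1)).lie →ₗ⁅ℝ⁆ Module.End ℂ V) (h : IsCohUnitaryIrrep ρK ρ𝔤) (δ : ℤ), (δ = 1 ∨ δ = -1) →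
        upqTypeClasses ρK ρ𝔤 h.gk.ad_compat 1 δ ≠ ⊥ → Module.finrank ℝ ↥(upqTypeClasses ρK ρ𝔤 h.gk.ad_compat 1 δ) = 2 :=
  Summit.HodgeConjecture.HodgeConjecture.Cruxes.H413.K2E1bDegOneFinrankEqTwo.DegOneFinrankEqTwo  -- ★ PAID (p854769, K2E1b-p15): re-tied by import (ED. 2)

/-! ## U6 — LEVEL B in `K`-type coordinates: the pin `[carrier with a 𝔭-type] = archDegOneClass` -/

/-- **FILE `Theorems/K2E1bClassEqArchDegOneOfPType.lean` (size L; LEVEL-B pin, JUNCTION J1: the identity E1's archimedean character rows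
(OWNER K2E4, R3 (a)) and row 10 need — «the honest `J`-carrier on the locus IS the class of record»).**  Let `V = ⊕_{(n,m) ∈ S} V_{n,m}` carry an irreducible
unitary cohomological `(𝔲(2,1), K)`-structure whose `𝔨`-action is Kovačević's (untwisted: locus, `e = 0`), `K`-type preserving, with trace-form Casimir `0`.
If a `𝔭`-TYPE OCCURS (`(2, 3) ∈ S` or `(2, −3) ∈ S`), then for some sign `δ` the class of `V` is ★ `archDegOneClass δ`: Casimir `0` + unitarity make every
`K`-equivariant `𝔭 → V` harmonic, so `H¹ = Hom_K(𝔭, V) ≠ 0` [BW II Prop. 3.1; VI (11)], its type is `δ = ±1` by ★ T6a∕T6d, and ★ T6c∕T6r rigidity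
[BW VI 4.11 (1); VZ Thm. 5.6] identifies the class with `archDegOneClass δ` (★ `areGKEquivalent_of_upqType_ne_bot`).  Which `δ` goes with which label
`±3` is left existential (LEVEL B proper = the prover's calibration against ★ `kovacevicTable_VI_4_11`: `ladderPlus = J_{1,0} ↔ H^{0,1}`).
WHY IT MIGHT FAIL: the step «Casimir `0` + unitary ⇒ all `K`-equivariant 1-cochains are classes» needs the harmonic theory of ★ `UpqHarmonicHodgeDecomposition`
for this (algebraic) unitary structure — available under ★ `IsUnitaryAlongP`, which `IsCohUnitaryIrrep` carries.
[BorelWallach2000 VI Thm. 4.11 (1)–(3); II Prop. 3.1] [Rogawski1990 Prop. 15.2.1 (b)] [VoganZuckerman1984 Thm. 5.6] [Kovacevic2021 §6 table]  audit: BW p0168.txt:L1–9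
(VI 4.11 (1)–(3)); p0067.txt:L11–13 (II 3.1∕5.3 harmonic frame); R90 p0244.txt:L10–17 «(b) … J^+ and J^− … Proof: [BW], Theorem 4.11».
deps: ★ F0P3bArchDegOneClass (`areGKEquivalent_of_upqType_ne_bot`, `archDegOneClass_spec`), ★ F0P3bArchDegOnePackage (T6a∕T6c∕T6d∕T6r), ★ UpqHarmonicHodgeDecomposition,
★ F0P3bKTypeIntegration (`ActsOnKTypes`, `kvec`), U2∕U3 `sig_K2E1bNoDegOneOfNoPTypes` (the converse direction's cochain identification, shared lemma).
[cite: BorelWallach2000, VI Thm. 4.11 (1)–(3); II Prop. 3.1] [cite: Rogawski1990, Prop. 15.2.1 (b)] [cite: VoganZuckerman1984, Thm. 5.6] [cite: Kovacevic2021, §6] -/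
theorem sig_K2E1bClassEqArchDegOneOfPType :
    ∀ (S : Set (ℤ × ℤ)) (ρK : Representation ℂ (uFormGroup (Fin 2) (Fin 1)).maximalCompact (KIdx S →₀ ℂ))
      (ρ𝔤 : (uFormGroup (Fin 2) (Fin 1)).lie →ₗ⁅ℝ⁆ Module.End ℂ (KIdx S →₀ ℂ)) (h : IsCohUnitaryIrrep ρK ρ𝔤),
      (∀ n m : ℤ, (n, m) ∈ S → 1 ≤ n) → ActsOnKTypes S ρ𝔤 →
        (∀ (g : (uFormGroup (Fin 2) (Fin 1)).maximalCompact) (n m k : ℤ),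
          ρK g (kvec S n m k) ∈ Submodule.span ℂ (Set.range fun l : ℤ => kvec S n m l)) →
        (∀ v : KIdx S →₀ ℂ, upqCasimirOp ρ𝔤 v = 0) →
          (((2 : ℤ), (3 : ℤ)) ∈ S ∨ ((2 : ℤ), (-3 : ℤ)) ∈ S) →
            ∃ (δ : ℤ) (hδ : δ = 1 ∨ δ = -1),
              GKIrrClass.ofModule (KIdx S →₀ ℂ) ρK ρ𝔤 h.gk h.irred = archDegOneClass δ hδ :=
  Summit.HodgeConjecture.HodgeConjecture.Cruxes.H413.K2E1bClassEqArchDegOneOfPType.classEqArchDegOneOfPType  -- ★ PAID (p854903, K2E1b-p16): re-tied by import (ED. 3)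

end Summit.HodgeConjecture.HodgeConjecture.Cruxes.H413.K2E1bGKCohomologyU21.U456

end
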